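import Literature.NumberTheory.LFunctions.Zhang2022.KnifeEdgeThreePiece
import Literature.NumberTheory.LFunctions.Zhang2022.RepairWallBand
import Literature.NumberTheory.LFunctions.Zhang2022.RepairRplusWallZero
import Literature.NumberTheory.LFunctions.Zhang2022.RepairInPrintLengths
import Literature.NumberTheory.LFunctions.Zhang2022.RepairAdmissibleShiftFree
import Literature.NumberTheory.LFunctions.Zhang2022.RepairFarBV
import Literature.NumberTheory.LFunctions.Zhang2022.RepairIntakeBmulti
import Literature.NumberTheory.LFunctions.Zhang2022.RepairBlenMuNu
import Literature.NumberTheory.LFunctions.Zhang2022.RepairBlenNuLipschitz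
import Literature.NumberTheory.LFunctions.Zhang2022.RepairBlenLambdaWhole
import Literature.NumberTheory.LFunctions.Zhang2022.RepairBandSlotMain

/-!
# Zhang (2022), programme F-S3 §E (cell landau-siegel, barrier extension, seat p3, stub S-E-p3-5): INTAKE of the
# §B word KILL(B-len) — the class `𝒟_len` (long mollifiers: at least one piece beyond Zhang's wall `θ* = 1`) as ONE
# design family `familyBlen` over a sum design type, one constructor per §2 stratum of the word, each dispatched to
# its LANDED `R⁺⁺` family; `blenWord` decided (v1)

Y. Zhang, *Discrete mean estimates and the Landau–Siegel zero*, arXiv:2211.02515v1 [Zhang2022LandauSiegel] —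
an unrefereed manuscript under adjudication. **WHAT THIS IS NOT: not a claim about Theorems 1–2 of
arXiv:2211.02515, about Landau–Siegel zeros, about a repaired `Margin232`, or about Parity; nothing here asserts any
claim of the manuscript or any estimate. The programme SEARCHES and TYPES; no claim until a kernel theorem says so.**
Intake file for the cell's second §B word (ls-barrier-plan 19:05:19Z, row S-E-p3-5; KILL-INTAKE.md v1.4 §5 recipe;
same shape as `RepairIntakeBmulti`). Nothing is re-proved: every verdict below is a landed `_decided` term.

## The word (C1 — the certificate's §1 VERBATIM)

Certificate OF RECORD: HOME/B-len/KILL-draft.md **v2.4 sha16 b46628540b6b957c** §1 («KILL(B-len) INSIDE 𝒟_len GIVEN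
B-AH (E-014, GLOBAL form)», (c)-door E-085; = REF-B1-COUNTERSIGNED v2.3 23f7f953463b7ce2 + REF-B1's wording erratum
E-len-1, countersignature 19:15:24Z, B-len/REF.md §3 067d704c98c4d577); word OF RECORD = ls-lead STATUS
2026-08-26T19:19:33Z under director-frontier's pre-authorisation 18:53:49Z, RATIFIED by director-frontier g6
19:31:07Z. This v1 covers the (L-a) χψ strata of §2 and the carried boxes ONLY; the (L-b) arithmetic strata (Λχψ
E-070/E-071, `μψ` E-072/E-073, `νψ` E-074′ — typed p461166 / p458584 / p461177) enter as the versioned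
`blenWord2` / `familyBlen2` when ls-barrier-p2's S-E-p2-6 rows (ls-Blen-typer-1 and -2: RepairBlenLambda, RepairBlenMuNu)
land — so C2 «class covered exactly» is PARTIAL at v1, by design (ls-B-ref-1 pre-read 19:31:18Z (n4)). §1 verbatim:

> «KILL(B-len) INSIDE 𝒟_len GIVEN B-AH (E-014) [director AMENDMENT 18:15:06Z / ls-lead RULE 18:15:52Z form; template B-multi KILL-CERT v2.2 09119f7aef1550b3]: no design d of the class 𝒟_len of §2 — long mollifiers, at least one coefficient piece with top θ ∈ (1, 2) beyond Zhang's wall θ* = 1 — closes Zhang's criterion at MAIN ORDER in the currency of §5 without an input of E*-len strength, where «E*-len strength» is, per coefficient class: (χψ-PPE) the off-diagonal MAIN TERM of the prime family at θ > 1 itself (E-002, open-in-print, XL) — because every smooth/bounded-variation structure beyond the band is INVISIBLE by THEOREM (E-003: `KnifeEdge.tailInvisible`/`tailInvisible_bv`, `discMeanFlat`/`discMeanFlat_bv`, `null_of_invisible`, `not_closes_of_invisible` with X = `invisibleForm θ`) and the two-piece wall-value-0 designs are DECIDED «no» in R⁺ (`Repair.InRplus`, `not_repairable_in_Rplus`;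 near-wall bookkeeping modulo E-004 `DiscMeanBandWidthWall0` as for every R⁺ two-piece row — barrier-ref 17:54:50Z); (Λχψ) a SIGN/PSD statement about the class off-diagonal main term — «X_Λ fails CompletedCS: ∃ v, K_Λ(v) + 2Re X_Λ(v,v) < 0 or |X_Λ(u,v)|² > 𝔅(u)(K_Λ(v) + 2Re X_Λ(v,v))» (E-071 with sign, XL-substantive by RANGE: primes at length p^θ to prime moduli p) — because the class diagonal K_Λ ≥ 0 (E-070, PNT rule, S) makes Cstar = 0 and the required strength Creq ≤ K/(2N_θ²) → 0 (§5), so C-boundedness is no protection and only the SIGN decides; (μψ one-sided) the same SIGN/PSD statement for X_μ (E-073, XL-substantive) — because M ≥ 0 ⇒ `not_robustMuPsiMargin_of_nonneg` (p458584); (νψ = (1∗χ)ψ) NOTHING can make it close: the class is invisible-(A) at main order (E-074′ `NuPieceInvisible`, derivation S verdict-inert, ls-theory RULING 17:33:45Z: TRUE(u ⊕ v_ν) = TRUE(u) = 𝔅(u) ≥ 0); each such SIGN/PSD negation contradicts B-AH (E-014 in its GLOBAL form — the PREMISE OF RECORD of this word, ERRATUM E-len-1 of REF-B1 19:15:24Z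 folded verbatim: exact Cauchy–Schwarz / positivity persists in the completed ⟨A⟩-world calculus of the class — here: the completed class off-diagonal X_𝒞 at θ > 1 satisfies CompletedCS; a PREDICTION with no lattice model behind it beyond the wall (the model-expectation identity's domain ends at P^{1+ε₀} — which is exactly why E-002 / E-071 / E-073 are XL = E*-len strength and why B-multi's exits x1/x3 are these classes); named, not proved. The certification of «no d closes without E*-len-strength input» does not USE B-AH: it holds by PRICE (the only levers E-002 / E-071 / E-073 ARE the E*-len-strength inputs), THEOREM (E-003, R⁺ mod E-004) and S-DERIVATION (E-074′); B-AH only predicts the sign those XL derivations would find; no «limit of PSD forms» argument is invoked or available) — an indefinite correctly-derived class block would be a main-order ¬(A)-exhibit = the (c)-door, registry row E-085 «non-model main-order entry» (open, none known, B-AH predicts none, owner §D/§E), which the cell uses in no word until the non-model step is named, theory-reviewed and kernel-checked (ls-ref-1 18:13:05Z wording; obj 18:20:41Z). The parts of the word that do NOT lean on B-AH: (χψ) THEOREMS E-003 + R⁺ decisions (modulo E-004); (ν) the invisibility derivation E-074′ (S); (Λ, μψ) the diagonal signs K_Λ ≥ 0 / M ≥ 0 (sums of squares) and hence Cstar = 0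 — only the exclusion of a sign-violating X_Λ / X_μ is «GIVEN B-AH», and that exclusion is exactly what E-071 / E-073 price (XL-substantive). Members certified: 189 = S0 69 (designs-scan1.json b65a2f4ec649bc85; the 35 (O1)/W1 rows COMPLETED with B-multi's landed band slots: «no (XL: E-006) [completed GIVEN B-AH = E-014 (derivation, heuristic): V ≥ 0 by E-034 KnifeEdge.bandK_nonneg (theorem); cross ≤ CS]», B j258258/j258193 × A j258337, PAIR-s0complete-AB 2540a94fa5813930 214/214) + BATCH-1 96 (BATCH-1.json 8722aa65fa5c11bf / v2 labels c516b3bb5a4103db) + BATCH-2 18 (BATCH-2.json c57eb04c297a400f) + BATCH-3 6 kernel-mode Λ rows (BATCH-3.json 7e2b17898a96282a; B j258259 × A j258337, PAIR-batch3-AB a21d31b2873093e4 198/198: 𝔅(g⋆) ∋ 0 and Creq_λ ∋ 0 on 6/6), DESIGN-MAP-len.md v0.8 466a1df1b6d1231c OF RECORD (v0.7 ccfad48eb16621a7 + M1 spelling of the 35 completed rows, obj-plan 19:03:24Z) (0 candidate rows, 0 INCOMPLETE rows; ls-ref-num PASS on §2.5 18:38:25Z/18:40:08Z for v0.6, v0.7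 adds only PASSed pairs); Candidates: 0; no number load-bearing; numbers two-lineage A ls-Blen-num-1 (j257197 S0 / j257503 + j257992 BATCH-1 / j257865 ν / j257794 BATCH-2 / j258337 BATCH-3 + S0-COMPLETE + Λ typed price) × B ls-Blen-num-2 (j257019 S0 / j257440 + j257894 BATCH-1 / j257754 ν / j257994 Λ typed price / j257712 BATCH-2 / j258259 BATCH-3 / j258193 + j258258 S0-COMPLETE), pair tables PAIR-scan1-AB v2 7d9dd02d37716314; PAIR-batch1-AB A 27044b32f9376112 / B 28cc55aeb4a928f1; PAIR-batch1v2-AB 394a6a79b5ad9052; 0 numeric disagreements anywhere; ls-ref-num custody PASS S0 69/69 (17:11:06Z pre + j257019/j257197), BATCH-1 3096/3120 (18:05:56Z; 24 NUM-LABEL naming), ν re-issue 48/48 (18:38:25Z), BATCH-2 18/18 (18:28:07Z); displayed slots typed: p458017 D-len-1/E-002 (KnifeEdgeOffDiagForm, review; + p461849 StrengthBelowReq = kernel Creq_offdiag) · p461166 E-070/E-071 (KnifeEdgeLambdaOverhang, rc 0 review-queued: `lambdaOverhangDiag`, `LambdaOverhangDiagNonneg`, `ELambdaOverhang`, `LambdaOverhangCS`,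 `not_eLambdaOverhangCloses_of_cs`, `not_eLambdaOverhangCloses_zero`, `LambdaCrossForm`, `not_closes_of_lambdaCrossForm`) · p458584 E-072/E-073 ACCEPTED a5fdea43a6fc · p461177 E-074′ ACCEPTED a019d5f97b1e (`NuPieceInvisible`, `NuMeanInvisible`, `not_nuCloses_of_invisible`, `nuDict_zero_of_meanInvisible`, `mainTerm_add_nuPiece`) · p457290 E-004 ACCEPTED 306743df204b; print ceiling CEILING-len.md v1 (θ_print < 1: `conreyIwaniecSoundararajanALS_theorem24`, `conreyIwaniecSoundararajan2019_theorem1`, `buiPrattRoblesZaharescu2020_theorem11/12`; RH-strength pricing `Radziwill2012_thm1`/`BettinGonek2017_thm1` PROVED in tree). Candidates: 0. Narrowings carried verbatim: n-len-1, n-len-2, n-len-3 (§2).»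

**PREMISE OF RECORD: B-AH (E-014)** — named, not proved; the (c)-door = registry row E-085. The parts that do NOT
lean on B-AH (the word's own list): (χψ) THEOREMS E-003 + the `R⁺` decisions (modulo the band slot E-004); (ν) the
invisibility derivation E-074′; (Λ, μψ) the diagonal signs.

## The class `𝒟_len` (KILL-draft §2, REF-B1-audited text) and its dispatch (this file, v1)

Common box: `fam = len`; `ℓ = 1`; detector `b = (1,2,3)`, weights cstar-printed or cstar-S; endgame ∈ {POS, CS};
finitely many PPE(ℚ[i]) pieces on rational supports ⊂ `[0,2]`, AT LEAST ONE with top `θ ∈ (1,2)`; Zhang's prime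
family. The open box `θ ∈ (1,2)` is the WORD's restriction, carried by the constructors' intended use and by the C4
witnesses (all taken with `1 < θ`); the families' own classes ask only `1 ≤ θ` (wider, so no design of the word is
lost — ls-B-ref-1 (n2)). The (O1) strata S3b (a wall JUMP: band height `W.hPlus ≠ u(1)`) and S3c (flat overhang from a
ZERO wall value: `u(1) = 0`, `W.hPlus ≠ 0`, far part to `s3farBV`) of DESIGN-MAP-len are `s1wall` (+ `s3farBV`) members
— `WallData.hPlus` and the wall value of a `KinkedProfile` are both free (`kblen_wallJump`, (n5)). Strata ↦ constructor
of `BlenDesign` ↦ covering family ↦ currency ↦ displayed slot(s) ↦ flag: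

| stratum of the word | constructor | family (file, p-id) | currency | displayed slot(s) | flag |
|---|---|---|---|---|---|
| (L-a.i) S1 one-piece `ϰ(θ,k)`-type continued THROUGH the wall (wall value `1 − 1/θ ≠ 0`): the band rows (O1)/W1 = `𝒟_multi`'s M3-wall coordinate — object of record the design truncated at the wall + band datum | `s1wall u u' W` | `KnifeEdge.familyWallBand` (RepairWallBand, p459421) | (A)-world MODEL main term `wallMainTerm` | WORLD: `∀ b, 0 ≤ K b` (E-005/E-034; `bandK_nonneg`), `WallCrossCS K X` (E-006; forced by the dictionary unless (A) eventually false, p460888) | model · conditional on B-AH |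
| (L-a.i) S1, its FAR part decided-flat (smooth `K`-Lipschitz, `‖·‖ ≤ M` beyond the wall; any lengths `P^{1+ε} ≤ N₁ ≤ N₂ ≤ P^{1+δ}` / top-vanishing) | `s1far d`, `s1top d` | `Repair.familySmoothLengths`, `Repair.familySmoothTop` (RepairRplusSmoothLengths, p457377) | discrete mean | (b) `Re ρ = ½` on the sampled zeros (displayed inside the verdict) | decided by THEOREM E-003 (PV), no E*-slot |
| (L-a.ii) S2 two-piece `u ⊕ v`, `u(1⁻) = 0 = v(1⁺)`, `v` smooth on `[1,θ]`, `v(θ) = 0` | `s2 θ u u' v v' s`, `s2joint d` | `Repair.familyTwoPiece` (RepairRplus, p455670), `Repair.familyTwoPieceJoint` (RepairRplusJoint, p457753) | `X`-world POS / JOINT | `KnifeEdge.InvisibleOverhang θ X` (E-002 slot; the invisible point is forced for smooth pieces: `null_of_invisible`, E-003) | decided in `R⁺` (D1/D2) modulo the displayed slot |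
| (L-a.ii)/(L-a.iii) two-piece with a ROUGH overhang (sharp top `v(θ⁻) ≠ 0`, steps, interior jumps of `v`; several bulk scalars; in-class probe) | `s2rough θ u u' v v' s`, `s2three d`, `s2roughJoint d` | `KnifeEdge.familyRoughTwoPiece` (p457552, E-4), `KnifeEdge.familyRoughThreePiece` / `familyRoughTwoPieceJoint` (p461544, E-12) | `X`-world POS / JOINT | WORLD: `BandNonnegOn` (E-005 object), `CrossSubordinateOn` (E-006 object), + `WorldLinearOn` (consistency) for the joint currency | X-world · slot-conditional |
| (L-a.iii) S3a far bounded-variation features at fixed `z₀ ≥ 1+ε₀` | `s3far c' δ ε g` (Lipschitz), `s3farBV d` (sup `≤ B`, variation `≤ V`) | `Repair.familyFarPiece` (RepairRplus, p455670), `Repair.familyFarBV` (RepairFarBV, ls-barrier-p4 S-E-p4-4) | discrete mean | (b) `Re ρ = ½` | decided by THEOREM E-033 (`tailInvisible_bv` p457577, `discMeanFlat_bv` p457806) |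
| two-piece wall-value-ZERO designs read FROM THE WALL in the discrete mean (near-wall bookkeeping) | `wall0 d`, `wall0top d` | `Repair.familyWallZero`, `Repair.familyWallZeroTop` (RepairRplusWallZero, p459259) | discrete mean | (c) `Repair.DiscMeanBandWidthWall0 c′ w C` (E-004, p458872) and (b) `Re ρ = ½` | CONDITIONAL on E-004 (flagged) |
| any `Theta` box with lengths in `(0,1]` (the `R̄`/`R⁺` part carried along) | `thetaBox θ` | `Repair.familyRLengths` (RepairAdmissibleShiftFree, p457555) | continued calculus, T-true | none | decided |
| «lengths ≥ P with ONLY in-print off-diagonal input» | `inPrint θ` | `Repair.familyInPrintLen` (RepairInPrintLengths, p459189) | continued calculus via `lengthsInUnit` below the wall | slot `Repair.InPrintOffDiagonalRange θ` — FALSE for every `ν₁ ≥ 1` (`not_inPrintControlled_of_one_le`) | **THRESHOLD T-2, NON-COVERING** (referee 18:03:34Z): «printed range = the wall exactly»; never a «no» for a lengths ≥ P design |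
| (L-b) arithmetic classes on the overhang: Λχψ (E-070/E-071), `μψ` one-sided (E-072/E-073), `νψ = (1∗χ)ψ` (E-074′) | — (v2) | p2's S-E-p2-6 rows over `KnifeEdgeLambdaOverhang` (p461166), `KnifeEdgeMuPsiOverhang` (p458584), `KnifeEdgeNuOverhang` (p461177) — pending | MODEL / SIGN | `LambdaOverhangDiagNonneg`, `LambdaOverhangCS`; `M ≥ 0`; `NuPieceInvisible` | pending p2 |

**NOT a row — «lengths ≥ P with general coefficients»:** the R⁺⁺ class has NO covering family for a long piece with
general bounded coefficients (the word's declared narrowing n-len-1: statement only, E-032 top > 1 half); the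
covering-by-independence statement is `Repair.lengthsBeyondP_independent` (ls-barrier-p1 S-E-p1-8, pending) and is
cited here as text only. UNCOVERED sub-words / exits (the word does not claim them; no theorem of the tree says «no»
there): (u1) the off-diagonal MAIN TERM of the prime family at `θ > 1` itself (E-002, open-in-print, XL) — exit x1 of
KILL(B-multi); (u2) a SIGN/PSD-violating `X_Λ` / `X_μ` (E-071 / E-073, XL-substantive) — excluded GIVEN B-AH only;
(u3) the (c)-door E-085; (u4) general bounded `a(n)` beyond `P` (n-len-1); (u5) L13 composite family (n-len-2) and knots
`θ ∈ (5/4, 2)` covered by price/structure only (n-len-3). Guards G1–G3 of COVERAGE.md apply verbatim (G1: 𝔅-currency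
rows carry `g(1) = 0`; a wall value `≠ 0` goes to `s1wall`, never to `thetaBox`).

## What this file provides (v1; later strata enter as the versioned `blenWord2` / `familyBlen2`, append-only)

`BlenDesign`, `KBlen`, `VBlen`, `familyBlen : Repair.DesignFamily`, `familyBlen_decided` (by cases from the landed
`_decided` terms / `Repair.not_repairable_in_Rplus`), `rplus_blen_decided`; `blenWord : List DesignFamily` (the fourteen
landed families) with `blenWord_decided`, `rplus_blenWord_decided`, `mem_blenWord_iff`; C2 by term (`kblen_*_iff`);
C4 witnesses (`kblen_inhabited`, all with `1 < θ`: the word's S1 shape `ϰ(21/20, 5/2)` truncated at the wall ⊕ flat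
band — wall value `≠ 0` —, `g⋆ ⊕ φ_θ`, `g⋆ ⊕ 𝟙_[1,θ)`, a far step, `θ₀`; `kblen_wallJump` for S3b/S3c). References: Zhang, arXiv:2211.02515v1, §2 (2.23)–(2.25), (2.30),
(2.32)–(2.33), §7 Prop 7.1 (7.2), §8 Lemma 8.1 [cite: Zhang2022LandauSiegel, §2 (2.32)–(2.33); §7 Prop 7.1 (7.2)];
cell files B-len/KILL-draft.md, barrier/ASSIGNMENTS.md S-E-p3-5, ls-barrier-plan/KILL-INTAKE.md v1.4, COVERAGE.md.
-/

noncomputable section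

open Complex Real Set
open _root_.MeasureTheory

namespace Literature.NumberTheory.LFunctions.Zhang2022

namespace Repair

open KnifeEdge

/-! ### Part 1 — the design type of `𝒟_len` (one constructor per stratum with a landed family), class, verdict -/

/-- **Designs of the killed class `𝒟_len`** (KILL-draft §2), one constructor per stratum with a landed `R⁺⁺` family
(module docstring table): `s1wall` (S1 through the wall: truncated bulk with FREE wall value + band datum), `s1far`,
`s1top` (S1 far part, smooth), `s2`, `s2joint` (S2 smooth two-piece, POS / JOINT), `s2rough`, `s2three`, `s2roughJoint`
(rough overhangs, several scalars, in-class probe), `s3far`, `s3farBV` (far Lipschitz / bounded-variation features), `wall0`, `wall0top` (from-the-wall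
disc-mean designs, CONDITIONAL E-004), `thetaBox` (any `Theta` box, lengths ≤ 1), `inPrint` (THRESHOLD T-2, non-covering).
[cite: Zhang2022LandauSiegel, §2 (2.32)–(2.33); §7 Prop 7.1 (7.2)] -/
inductive BlenDesign : Type
  | s1wall (u u' : ℝ → ℂ) (W : WallData)
  | s1far (d : SmoothDesign)
  | s1top (d : SmoothTopDesign)
  | s2 (θ : ℝ) (u u' v v' : ℝ → ℂ) (s : ℂ)
  | s2joint (d : JointDesign)
  | s2rough (θ : ℝ) (u u' v v' : ℝ → ℂ) (s : ℂ)
  | s2three (d : ThreePieceDesign)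
  | s2roughJoint (d : JointDesign)
  | s3far (c' δ ε : ℝ) (g : ℝ → ℂ)
  | s3farBV (d : FarBVData)
  | wall0 (d : WallZeroDesign)
  | wall0top (d : WallZeroTopDesign)
  | thetaBox (θ : Theta)
  | inPrint (θ : Theta)

/-- **Membership in `𝒟_len`** = the covering family's class (NO analytic hypothesis anywhere).
[cite: Zhang2022LandauSiegel, §2 (2.32)–(2.33); §7 Prop 7.1 (7.2)] -/
def KBlen : BlenDesign → Prop
  | .s1wall u u' W => familyWallBand.InClass (u, u', W)
  | .s1far d => familySmoothLengths.InClass d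
  | .s1top d => familySmoothTop.InClass d
  | .s2 θ u u' v v' s => familyTwoPiece.InClass (θ, u, u', v, v', s)
  | .s2joint d => familyTwoPieceJoint.InClass d
  | .s2rough θ u u' v v' s => familyRoughTwoPiece.InClass (θ, u, u', v, v', s)
  | .s2three d => familyRoughThreePiece.InClass d
  | .s2roughJoint d => familyRoughTwoPieceJoint.InClass d
  | .s3far c' δ ε g => familyFarPiece.InClass (c', δ, ε, g)
  | .s3farBV d => familyFarBV.InClass d
  | .wall0 d => familyWallZero.InClass d
  | .wall0top d => familyWallZeroTop.InClass d
  | .thetaBox θ => familyRLengths.InClass θ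
  | .inPrint θ => familyInPrintLen.InClass θ

/-- **The verdict «no main-order closing without an E*-len-strength input»**, stratum by stratum = the covering
family's verdict with its slots DISPLAYED there (see the module docstring table for currency, slot kind and flag; the
`inPrint` row is a THRESHOLD — its slot is false for every length ≥ P — and is carried as such, not as coverage).
[cite: Zhang2022LandauSiegel, §2 (2.32)–(2.33); §7 Prop 7.1 (7.2)] -/
def VBlen : BlenDesign → Prop
  | .s1wall u u' W => familyWallBand.Verdict (u, u', W)
  | .s1far d => familySmoothLengths.Verdict d
  | .s1top d => familySmoothTop.Verdict d
  | .s2 θ u u' v v' s => familyTwoPiece.Verdict (θ, u, u', v, v', s)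
  | .s2joint d => familyTwoPieceJoint.Verdict d
  | .s2rough θ u u' v v' s => familyRoughTwoPiece.Verdict (θ, u, u', v, v', s)
  | .s2three d => familyRoughThreePiece.Verdict d
  | .s2roughJoint d => familyRoughTwoPieceJoint.Verdict d
  | .s3far c' δ ε g => familyFarPiece.Verdict (c', δ, ε, g)
  | .s3farBV d => familyFarBV.Verdict d
  | .wall0 d => familyWallZero.Verdict d
  | .wall0top d => familyWallZeroTop.Verdict d
  | .thetaBox θ => familyRLengths.Verdict θ
  | .inPrint θ => familyInPrintLen.Verdict θ

/-- **The killed class as ONE family** `familyBlen = ⟨BlenDesign, KBlen, VBlen⟩`. [cite: Zhang2022LandauSiegel, §2 (2.32)–(2.33); §7 Prop 7.1 (7.2)] -/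
def familyBlen : DesignFamily where
  Design := BlenDesign
  InClass := KBlen
  Verdict := VBlen

/-- **`𝒟_len` (v1 strata) IS DECIDED** — by cases, from the landed terms (nothing re-proved).
[cite: Zhang2022LandauSiegel, §2 (2.32)–(2.33); §7 Prop 7.1 (7.2)] -/
theorem familyBlen_decided : familyBlen.Decided
  | .s1wall u u' W, h => familyWallBand_decided (u, u', W) h
  | .s1far d, h => familySmoothLengths_decided d h
  | .s1top d, h => familySmoothTop_decided d h
  | .s2 θ u u' v v' s, h => not_repairable_in_Rplus (.twoPiece θ u u' v v' s) h
  | .s2joint d, h => familyTwoPieceJoint_decided d h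
  | .s2rough θ u u' v v' s, h => familyRoughTwoPiece_decided (θ, u, u', v, v', s) h
  | .s2three d, h => familyRoughThreePiece_decided d h
  | .s2roughJoint d, h => familyRoughTwoPieceJoint_decided d h
  | .s3far c' δ ε g, h => not_repairable_in_Rplus (.farPiece c' δ ε g) h
  | .s3farBV d, h => familyFarBV_decided d h
  | .wall0 d, h => familyWallZero_decided d h
  | .wall0top d, h => familyWallZeroTop_decided d h
  | .thetaBox θ, h => familyRLengths_decided θ h
  | .inPrint θ, h => familyInPrintLen_decided θ h

/-- **`R⁺ ++ [𝒟_len]` is decided** (`Repair.rplus_extend`). [cite: Zhang2022LandauSiegel, §2 (2.32)–(2.33)] -/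
theorem rplus_blen_decided : ClassDecided (Rplus ++ [familyBlen]) :=
  rplus_extend familyBlen_decided

/-! ### Part 2 — the word as a LIST of the covering families (v1 = the thirteen landed ones) -/

/-- **The word's families, v1** (all landed; the (L-b) rows of p2 join as `blenWord2`).
[cite: Zhang2022LandauSiegel, §2 (2.32)–(2.33); §7 Prop 7.1 (7.2)] -/
def blenWord : List DesignFamily :=
  [familyWallBand, familySmoothLengths, familySmoothTop, familyTwoPiece, familyTwoPieceJoint, familyRoughTwoPiece,
    familyRoughThreePiece, familyRoughTwoPieceJoint, familyFarPiece, familyFarBV, familyWallZero, familyWallZeroTop,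
    familyRLengths, familyInPrintLen]

/-- **The word's families are decided.** [cite: Zhang2022LandauSiegel, §2 (2.32)–(2.33); §7 Prop 7.1 (7.2)] -/
theorem blenWord_decided : ClassDecided blenWord :=
  classDecided_cons familyWallBand_decided <|
    classDecided_cons familySmoothLengths_decided <|
      classDecided_cons familySmoothTop_decided <|
        classDecided_cons (fun p h =>
            not_repairable_in_Rplus (.twoPiece p.1 p.2.1 p.2.2.1 p.2.2.2.1 p.2.2.2.2.1 p.2.2.2.2.2) h) <|
          classDecided_cons familyTwoPieceJoint_decided <|
            classDecided_cons familyRoughTwoPiece_decided <|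
              classDecided_cons familyRoughThreePiece_decided <|
                classDecided_cons familyRoughTwoPieceJoint_decided <|
                  classDecided_cons (fun p h => not_repairable_in_Rplus (.farPiece p.1 p.2.1 p.2.2.1 p.2.2.2) h) <|
                   classDecided_cons familyFarBV_decided <|
                    classDecided_cons familyWallZero_decided <|
                      classDecided_cons familyWallZeroTop_decided <|
                        classDecided_cons familyRLengths_decided <|
                          classDecided_cons familyInPrintLen_decided classDecided_nil

/-- **`R⁺ ++ blenWord` is decided.** [cite: Zhang2022LandauSiegel, §2 (2.32)–(2.33)] -/
theorem rplus_blenWord_decided : ClassDecided (Rplus ++ blenWord) :=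
  classDecided_append.2 ⟨rplus_decided, blenWord_decided⟩

/-- The families of the word, by name. [cite: Zhang2022LandauSiegel, §2 (2.32)–(2.33)] -/
theorem mem_blenWord_iff (F : DesignFamily) :
    F ∈ blenWord ↔ F = familyWallBand ∨ F = familySmoothLengths ∨ F = familySmoothTop ∨ F = familyTwoPiece ∨
      F = familyTwoPieceJoint ∨ F = familyRoughTwoPiece ∨ F = familyRoughThreePiece ∨ F = familyRoughTwoPieceJoint ∨
      F = familyFarPiece ∨ F = familyFarBV ∨ F = familyWallZero ∨ F = familyWallZeroTop ∨ F = familyRLengths ∨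
      F = familyInPrintLen := by
  simp only [blenWord, List.mem_cons, List.not_mem_nil, or_false]

/-! ### Part 3 — C2 by term and embeddings -/

/-- Each constructor IS its family (class and verdict by `Iff.rfl`), recorded for the three `X`-world / model rows the
referee reads first. [cite: Zhang2022LandauSiegel, §7 Prop 7.1 (7.2)] -/
theorem kblen_rows_iff (u u' : ℝ → ℂ) (W : WallData) (θ : ℝ) (v v' : ℝ → ℂ) (s : ℂ) :
    (KBlen (.s1wall u u' W) ↔ familyWallBand.InClass (u, u', W)) ∧
      (VBlen (.s1wall u u' W) ↔ familyWallBand.Verdict (u, u', W)) ∧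
      (KBlen (.s2 θ u u' v v' s) ↔ familyTwoPiece.InClass (θ, u, u', v, v', s)) ∧
      (VBlen (.s2 θ u u' v v' s) ↔ familyTwoPiece.Verdict (θ, u, u', v, v', s)) ∧
      (KBlen (.s2rough θ u u' v v' s) ↔ familyRoughTwoPiece.InClass (θ, u, u', v, v', s)) ∧
      (VBlen (.s2rough θ u u' v v' s) ↔ familyRoughTwoPiece.Verdict (θ, u, u', v, v', s)) :=
  ⟨Iff.rfl, Iff.rfl, Iff.rfl, Iff.rfl, Iff.rfl, Iff.rfl⟩

/-- EMBEDDING: every class-`R` design is a `thetaBox` member; every `R⁺` two-piece design is an `s2` member AND an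
`s2rough` member (`OverhangPiece.rough`); every `R⁺` far piece is an `s3far` member.
[cite: Zhang2022LandauSiegel, §2 (2.32)–(2.33); §7 Prop 7.1 (7.2)] -/
theorem kblen_of_inRplus {θr : Theta} (hr : AdmissibleTheta θr) {θ : ℝ} {u u' v v' : ℝ → ℂ} {s : ℂ}
    (h2 : InRplus (.twoPiece θ u u' v v' s)) {c' δ ε : ℝ} {g : ℝ → ℂ} (hf : InRplus (.farPiece c' δ ε g)) :
    KBlen (.thetaBox θr) ∧ KBlen (.s2 θ u u' v v' s) ∧ KBlen (.s2rough θ u u' v v' s) ∧ KBlen (.s3far c' δ ε g) :=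
  ⟨hr.lengthsInUnit, h2, ⟨h2.1, h2.2.1, h2.2.2.rough⟩, hf⟩

/-- The `inPrint` row is a THRESHOLD, not coverage: its displayed slot is FALSE on every design with a length `≥ P`
(`Repair.not_inPrintControlled_of_one_le` territory) — recorded by citing the equivalence of record
`Repair.inPrintOffDiagonalRange_iff_belowP`'s consequence for the class: membership is `AdmissibleThetaLen` only.
[cite: Zhang2022LandauSiegel, §7 (7.2), (7.15)] -/
theorem kblen_inPrint_iff (θ : Theta) : KBlen (.inPrint θ) ↔ AdmissibleThetaLen θ := Iff.rfl

/-! ### Part 4 — C4: the class is inhabited, stratum by stratum -/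

/-- **C4 (every witness with `1 < θ`, inside the word's open box).** The word's S1 shape LITERALLY — Zhang's long
`H₁₂`-piece `ϰ(21/20, 5/2)` truncated at the wall, wall value `ϰ(1) ≠ 0` (`Repair.kinkedProfile_kappaP_long`,
`Repair.kappaP_one_ne_zero`, RepairIntakeBmulti), continued flat through the band at that value; the smooth two-piece
`g⋆ ⊕ φ_θ` (POS and, against `g⋆`, JOINT); the rough `g⋆ ⊕ 𝟙_[1,θ)`; a far step (multi-far-001's lengths); the printed
`θ₀` as a Theta box. [cite: Zhang2022LandauSiegel, (2.23)–(2.25); §7 Prop 7.1 (7.2)] -/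
theorem kblen_inhabited {θ : ℝ} (hθ : 1 < θ) (s : ℂ) :
    KBlen (.s1wall (kappaP (21/20) (5/2)) (kappaP' (21/20) (5/2)) (WallData.flat (kappaP (21/20) (5/2) 1))) ∧
      kappaP (21/20) (5/2) 1 ≠ 0 ∧
      KBlen (.s2 θ gStar gStar' (phiT θ) (phiT' θ) s) ∧
      KBlen (.s2joint ⟨θ, gStar, gStar', phiT θ, phiT' θ, s, gStar, gStar'⟩) ∧
      KBlen (.s2rough θ gStar gStar' (plateau θ) (fun _ => 0) s) ∧
      KBlen (.s3farBV ⟨0, 1, 1 / 4, 1, 1, farStep⟩) ∧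
      KBlen (.thetaBox theta0) :=
  ⟨kinkedProfile_kappaP_long (by norm_num), kappaP_one_ne_zero (by norm_num), inRplus_gStar_phiT hθ.le s,
    familyTwoPieceJoint_inClass_star hθ.le s, familyRoughTwoPiece_inClass_gStar_plateau hθ.le s,
    inClass_farStep 0 (by norm_num) (by norm_num), admissible_theta0.lengthsInUnit⟩

/-- **S3b / S3c by term** (ls-B-ref-1 (n5)): a wall JUMP (band height `h ≠ u(1)`, e.g. `h = u(1)/2`) and a flat
overhang from a ZERO wall value (`u(1) = 0`, `h ≠ 0`) are `s1wall` members — membership is `KinkedProfile u u'`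
whatever the band datum. [cite: Zhang2022LandauSiegel, §2 (2.30); §7 Prop 7.1 (7.2)] -/
theorem kblen_wallJump {u u' : ℝ → ℂ} (hu : KinkedProfile u u') (h : ℂ) (b : WallData) :
    KBlen (.s1wall u u' (WallData.flat h)) ∧ KBlen (.s1wall u u' b) ∧
      (KBlen (.s1wall u u' (WallData.flat h)) ↔ KinkedProfile u u') :=
  ⟨hu, hu, Iff.rfl⟩

/-- **Slots load-bearing, by stratum (pointers, one term each):** S1-wall (`eMultiBandCloses_exhibit`, p459723), S2 smooth
in the world `X = 0` (`Repair.closesByPositivity_zero`, p456612), S2 rough (`rough_closesByPositivity_zero`, p457552).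
[cite: Zhang2022LandauSiegel, §7 Prop 7.1 (7.2), §8 Lemma 8.1] -/
theorem blen_slots_loadBearing {θ : ℝ} (hθ : 1 < θ) :
    EMultiBandCloses bandK crossNegWorld ∧ ClosesByPositivity θ 0 ∧ ClosesByPositivityOn (RoughOverhangPiece θ) θ 0 :=
  ⟨eMultiBandCloses_exhibit, closesByPositivity_zero hθ, rough_closesByPositivity_zero hθ⟩

/-! ### Part 5 — the list v2: the three (L-b) strata join — Λ (`familyLambdaOverhangAll` + graded twin
`familyLambdaGradedAll`, p467353, ls-Blen-typer-1 g2), μψ (`familyMuPsiOverhangAll`) and νψ (`familyNuOverhangAll`)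
(p469249, ls-Blen-typer-1 g2) — and the MAIN-SCALE twins of the wall0 rows join (`familyWallZeroMain`,
`familyWallZeroTopMain`, p466556, ls-barrier-p2 g2)

**C1.** The WORD is the §1 text quoted VERBATIM in this file's module docstring (v1, p465008; unchanged): «KILL(B-len)
INSIDE 𝒟_len GIVEN B-AH (E-014)» — B-AH in its GLOBAL form «exact Cauchy–Schwarz / positivity persists in the completed
⟨A⟩-world calculus of the class» (certificate sentence E-len-1), the (c)-door E-085 «non-model main-order entry» named and
used in no word; of record ls-lead 2026-08-26T19:19:33Z, REF-B1 countersignature 19:15:24Z; certificate B-len/KILL-draft.md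
v2.4 sha16 b46628540b6b957c. **The family theorems below do not use B-AH**; it is the premise for reading the displayed
slots as (A)-world properties. The (L-b) sub-class text, VERBATIM (§2): «(L-b) arithmetic coefficient classes on an
OVERHANG piece [1, θ] (or whole profile [0, θ]) glued to an in-class bulk: Λχψ-type a(n) = χψ(n)·(Λ^{∗k}/log^k P)(n)·v(z_n),
k ≤ 2 (S1-Λ; rows E-070/E-071); μψ one-sided whole-profile g on [0, b], b ∈ (1,2) (rows E-072/E-073); νψ = (1∗χ)ψ·v(z_n) and
its variants ν·log n, ν∗(smooth), (1∗χ)(P_j/n)^β (S3; row E-074′ — invisible-(A)); [general bounded a(n), |a(n)| ≤ 1,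
arbitrary beyond P: STATEMENT ONLY (E-032 top > 1 half) = n-len-1].»

| constructor (v2) | stratum (members of record, B-len/designs, DESIGN-MAP-len v0.8 466a1df1b6d1231c) | family (file, p-id) | currency | displayed slots (kind (c) unless said) | flag |
|---|---|---|---|---|---|
| `lam` | (L-b)∣Λ: Λχψ-type piece on `[1,θ]`, `θ > 1`, `k ≥ 1`, ONE Λ-piece per design, in-class kinked bulk `u(1) = 0` — the 54 `len-lam-*` rows (`lenLamBump`, `lenLamGstarMV`, every polynomial piece `overhang_polyPiece`) | `Repair.familyLambdaOverhangAll` (RepairBlenLambda, p467353) — THE WORD'S CURRENCY ROW for (L-b)∣Λ | MODEL (E-070/E-071, beyond-the-wall twin of E-14) | worlds `(K, X)` as binders: `LambdaOverhangDiagNonneg θ K` (E-070) ∧ `LambdaOverhangCS θ K X` (E-071; diagonal redundant given CS) | CONDITIONAL «GIVEN B-AH (E-014)»; threshold `lambdaOverhangNull_iff`; (c)-door = `LambdaOverhangIndefinite` (E-085), the ONLY door (`eLambdaOverhangCloses_iff_indefinite`); WIDER than the word in `θ` (any `θ > 1`) and `k` (any `k ≥ 1`) |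
| `lamGra` | the SAME (L-b)∣Λ class in the GRADED currency (p462691) — a SECOND CURRENCY, coverage counted ONCE (barrier-ref N1 20:27:24Z) | `Repair.familyLambdaGradedAll` (p467353) | MODEL, `𝔞`-graded cross | `LambdaOverhangDiagNonneg θ K` ∧ `LambdaGradedCS θ K G` | CONDITIONAL «GIVEN B-AH (E-014)»; not a coverage count |
| `mu` | (L-b)∣μψ: ONE-SIDED whole profile on `[0, b]`, `b > 1` (p458584's `OneSidedProfile b g g′`) — the 18 `len-mu-*` rows (`lenMuZhang`, `lenMuQuad`, `lenMuPlateau`) | `Repair.familyMuPsiOverhangAll` (RepairBlenMuNu, p469249) | MODEL / ROBUST-price currency of E-073: worlds `(C ≥ 0, M)` as binders, verdict «no robust-margin witness: `¬ (M(g,g′) + C·N_b(g)² < 0)`» | `MuPsiDiagNonneg b M` (E-072 sign; inhabited by the candidate `sqfreeDiagMass`, for which the row is DECIDED outright) | CONDITIONAL-ROBUST «GIVEN the E-072 sign»; threshold T-μψ-2 (p465279) + `muPsi_null_iff_not_robustMargin`; load-bearing `muPsiDiag_slot_loadBearing`; WIDER than the word in `b` (any `b > 1`) |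
| `nu` | (L-b)∣νψ: plain `ν = 1∗χ` overhang piece on `[1,θ]`, `θ > 1`, BV profile (`KnifeEdge.bvOverhang θ v v′`, the ruling's class) — the 48 `len-nu-*` rows (`lenNuBump`, `lenNuRampcut`, `bvOverhang_polyProf`; the 12 rampcut = jump rows are counted HERE, the 36 continuous rows under the DECIDED Lipschitz sub-row of S-E-bt2-2 when it lands — stronger currency wins, each row once) | `Repair.familyNuOverhangAll` (RepairBlenMuNu, p469249) | INVISIBILITY currency: worlds `(c′, S)`; verdict = dictionary of record `(M, X) = (0, 0)` ∧ LEVER-FREE (added to ANY bulk with main constant `m ≥ 0` the constant stays `m`) | `NuMeanInvisible c′ θ (bvOverhang θ) S` (E-074′, derivation S) + `ScaleEventuallyPos S`, `Prop22i`, `Lemma23 c′` as (b)-binders | DECIDED-GIVEN-SLOT; contains the Lipschitz sub-class by term (`NuDesign.inClass_of_lipOverhang`, `inClass_lipTent`) |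
| `wall0Main` | (L-a.i) smooth wall-zero profiles from the wall to any bounded length — the MAIN-SCALE reading of row `wall0` (same class, `kblen2_wall0Main_iff_wall0`) | `Repair.familyWallZeroMain` (RepairBandSlotMain, p466556) | discrete mean at the MAIN scale `𝔞𝔓` | `Repair.DiscMeanBandMain c′ w η` (E-004 AT THE MAIN SCALE, inside the verdict) · `Re ρ = ½` (b) | CONDITIONAL on E-004 (main-scale reading); SUPERSEDES `wall0` FOR COVERAGE (ls-barrier-plan g1 ruling 20:40:37Z: `wall0`/`wall0top` keep the flag «TRIVIAL-SCALE CURRENCY: `discWeight = (8/π)𝓛⁹𝔓 + O(𝓛²𝔓)` vs `𝔞𝔓` (p467613), verdict not probative at fixed `(w, C)`»); WIDER than the certificate's §4 row E-004, which names the trivial-scale decls `Repair.DiscMeanBandWidthWall0` / `KnifeEdge.DiscMeanUpperWidth` of record at countersignature — certificate text unchanged, no erratum |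
| `wall0TopMain` | (L-a.i) wall-zero, declared top `θ`, full polynomial — MAIN-SCALE reading of `wall0top` | `Repair.familyWallZeroTopMain` (p466556) | discrete mean, MAIN scale | `DiscMeanBandMain c′ w η` · `Re ρ = ½` | CONDITIONAL on E-004 (main-scale); SUPERSEDES `wall0top` FOR COVERAGE |

STILL PENDING (v3): the DECIDED Lipschitz νψ sub-row (`familyNuLipOverhangAll`, ls-Blen-typer-2 g2, S-E-bt2-2) — shipped when
it lands, never blocking (planner (d)). UNCOVERED SUB-WORDS — u1–u5 of the module docstring stand VERBATIM; ADDED (statement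
only, NO family may claim them, 0 design rows of record): (u6) the one-piece Λχψ profile on the WHOLE range `[0, θ]`
straddling the wall — class text of (L-b) «(or whole profile [0, θ])»; all 54 Λ rows are on `[1,θ]`; NOT a member of
`familyLambdaOverhangAll` (RepairBlenLambda declared narrowing (ii): read as two Λ-pieces it is a three-block mixed member,
the Gram-family shape of RepairGramBlock, not claimed); (u7) the ν VARIANTS «ν·log n, ν∗(smooth), (1∗χ)(P_j/n)^β» — 0 design
rows; NOT members of `familyNuOverhangAll` (RepairBlenMuNu declared narrowing). Writer of this Part: ls-barrier-p1 g2 for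
ls-barrier-p3 (NEXT-APPENDS.md §B recipe, HOME/barrier/p3/; ls-barrier-plan g1 ruling 21:21:29Z; ls-Blen-plan g2 liaison asks
21:25:40Z (i)–(v)). FRAMING: the programme SEARCHES and TYPES; no claim about Landau–Siegel zeros, Theorems 1–2 of
arXiv:2211.02515 or a repaired Margin232 until a kernel theorem says so. -/

/-- **The word's families, v2** = v1 ++ `[familyLambdaOverhangAll, familyLambdaGradedAll, familyMuPsiOverhangAll,
familyNuOverhangAll, familyWallZeroMain, familyWallZeroTopMain]`. [cite: Zhang2022LandauSiegel, §2 (2.32)–(2.33); §7 Prop 7.1 (7.2)] -/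
def blenWord2 : List DesignFamily :=
  blenWord ++ [familyLambdaOverhangAll, familyLambdaGradedAll, familyMuPsiOverhangAll, familyNuOverhangAll,
    familyWallZeroMain, familyWallZeroTopMain]

/-- **v2 is decided** (`blenWord_decided` + the six landed `_decided` terms). [cite: Zhang2022LandauSiegel, §2 (2.32)–(2.33)] -/
theorem blenWord2_decided : ClassDecided blenWord2 :=
  classDecided_append.2 ⟨blenWord_decided,
    classDecided_cons familyLambdaOverhangAll_decided <| classDecided_cons familyLambdaGradedAll_decided <|
      classDecided_cons familyMuPsiOverhangAll_decided <| classDecided_cons familyNuOverhangAll_decided <|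
        classDecided_cons familyWallZeroMain_decided <| classDecided_cons familyWallZeroTopMain_decided classDecided_nil⟩

/-- `R⁺ ++ blenWord2` is decided. [cite: Zhang2022LandauSiegel, §2 (2.32)–(2.33)] -/
theorem rplus_blenWord2_decided : ClassDecided (Rplus ++ blenWord2) :=
  classDecided_append.2 ⟨rplus_decided, blenWord2_decided⟩

/-- v1 is a prefix of v2. [cite: Zhang2022LandauSiegel, §2 (2.32)–(2.33)] -/
theorem blenWord_sub_blenWord2 : ∀ F ∈ blenWord, F ∈ blenWord2 :=
  fun _ hF => List.mem_append.2 (Or.inl hF)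

/-- The families of v2, by name. [cite: Zhang2022LandauSiegel, §2 (2.32)–(2.33)] -/
theorem mem_blenWord2_iff (F : DesignFamily) :
    F ∈ blenWord2 ↔ F = familyWallBand ∨ F = familySmoothLengths ∨ F = familySmoothTop ∨ F = familyTwoPiece ∨
      F = familyTwoPieceJoint ∨ F = familyRoughTwoPiece ∨ F = familyRoughThreePiece ∨ F = familyRoughTwoPieceJoint ∨
      F = familyFarPiece ∨ F = familyFarBV ∨ F = familyWallZero ∨ F = familyWallZeroTop ∨ F = familyRLengths ∨
      F = familyInPrintLen ∨ F = familyLambdaOverhangAll ∨ F = familyLambdaGradedAll ∨ F = familyMuPsiOverhangAll ∨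
      F = familyNuOverhangAll ∨ F = familyWallZeroMain ∨ F = familyWallZeroTopMain := by
  simp only [blenWord2, blenWord, List.cons_append, List.nil_append, List.mem_cons, List.not_mem_nil, or_false]

/-- **Designs of `𝒟_len`, v2**: v1 plus `lam` (`Repair.LambdaOverhangDesign`), `lamGra` (`Repair.LambdaGradedDesign`),
`mu` (`Repair.MuPsiDesign`), `nu` (`Repair.NuDesign`), `wall0Main` (`Repair.WallZeroDesign`), `wall0TopMain`
(`Repair.WallZeroTopDesign`). [cite: Zhang2022LandauSiegel, §2 (2.32)–(2.33); §7 Prop 7.1 (7.2)] -/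
inductive BlenDesign2 : Type
  | ofV1 (d : BlenDesign)
  | lam (d : LambdaOverhangDesign)
  | lamGra (d : LambdaGradedDesign)
  | mu (d : MuPsiDesign)
  | nu (d : NuDesign)
  | wall0Main (d : WallZeroDesign)
  | wall0TopMain (d : WallZeroTopDesign)

/-- Membership, v2 (NO analytic hypothesis: `lam`/`lamGra` = kinked bulk, `u(1) = 0`, `L.Overhang θ v′`; `mu` = `1 < b`,
`OneSidedProfile b g g′`; `nu` = `1 < θ`, `bvOverhang θ v v′`; `wall0Main`/`wall0TopMain` = the classes of `wall0`/`wall0top`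
UNCHANGED). [cite: Zhang2022LandauSiegel, §2 (2.32)–(2.33); §7 Prop 7.1 (7.2)] -/
def KBlen2 : BlenDesign2 → Prop
  | .ofV1 d => KBlen d
  | .lam d => familyLambdaOverhangAll.InClass d
  | .lamGra d => familyLambdaGradedAll.InClass d
  | .mu d => familyMuPsiOverhangAll.InClass d
  | .nu d => familyNuOverhangAll.InClass d
  | .wall0Main d => familyWallZeroMain.InClass d
  | .wall0TopMain d => familyWallZeroTopMain.InClass d

/-- Verdict, v2 = the covering family's verdict with its slots DISPLAYED there (table above).
[cite: Zhang2022LandauSiegel, §2 (2.32)–(2.33); §7 Prop 7.1 (7.2)] -/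
def VBlen2 : BlenDesign2 → Prop
  | .ofV1 d => VBlen d
  | .lam d => familyLambdaOverhangAll.Verdict d
  | .lamGra d => familyLambdaGradedAll.Verdict d
  | .mu d => familyMuPsiOverhangAll.Verdict d
  | .nu d => familyNuOverhangAll.Verdict d
  | .wall0Main d => familyWallZeroMain.Verdict d
  | .wall0TopMain d => familyWallZeroTopMain.Verdict d

/-- **`𝒟_len` as one family, v2.** [cite: Zhang2022LandauSiegel, §2 (2.32)–(2.33)] -/
def familyBlen2 : DesignFamily where
  Design := BlenDesign2
  InClass := KBlen2
  Verdict := VBlen2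

/-- **v2 is decided** — by cases, from the landed terms (nothing re-proved). [cite: Zhang2022LandauSiegel, §2 (2.32)–(2.33)] -/
theorem familyBlen2_decided : familyBlen2.Decided
  | .ofV1 d, h => familyBlen_decided d h
  | .lam d, h => familyLambdaOverhangAll_decided d h
  | .lamGra d, h => familyLambdaGradedAll_decided d h
  | .mu d, h => familyMuPsiOverhangAll_decided d h
  | .nu d, h => familyNuOverhangAll_decided d h
  | .wall0Main d, h => familyWallZeroMain_decided d h
  | .wall0TopMain d, h => familyWallZeroTopMain_decided d h

/-- `R⁺ ++ [𝒟_len v2]` is decided. [cite: Zhang2022LandauSiegel, §2 (2.32)–(2.33)] -/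
theorem rplus_blen2_decided : ClassDecided (Rplus ++ [familyBlen2]) :=
  rplus_extend familyBlen2_decided

/-- v1 embeds into v2 unchanged. [cite: Zhang2022LandauSiegel, §2 (2.32)–(2.33)] -/
theorem kblen2_ofV1_iff (d : BlenDesign) : (KBlen2 (.ofV1 d) ↔ KBlen d) ∧ (VBlen2 (.ofV1 d) ↔ VBlen d) :=
  ⟨Iff.rfl, Iff.rfl⟩

/-- Each new constructor IS its family's row (class and verdict by `Iff.rfl`). [cite: Zhang2022LandauSiegel, §7 Prop 7.1 (7.2)] -/
theorem kblen2_rows_iff (d : LambdaOverhangDesign) (e : LambdaGradedDesign) (m : MuPsiDesign) (n : NuDesign)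
    (f : WallZeroDesign) (g : WallZeroTopDesign) :
    (KBlen2 (.lam d) ↔ d.InClass) ∧ (VBlen2 (.lam d) ↔ familyLambdaOverhangAll.Verdict d) ∧
      (KBlen2 (.lamGra e) ↔ e.InClass) ∧ (VBlen2 (.lamGra e) ↔ familyLambdaGradedAll.Verdict e) ∧
      (KBlen2 (.mu m) ↔ m.InClass) ∧ (VBlen2 (.mu m) ↔ familyMuPsiOverhangAll.Verdict m) ∧
      (KBlen2 (.nu n) ↔ n.InClass) ∧ (VBlen2 (.nu n) ↔ familyNuOverhangAll.Verdict n) ∧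
      (KBlen2 (.wall0Main f) ↔ f.InClass) ∧ (VBlen2 (.wall0Main f) ↔ f.VerdictMain) ∧
      (KBlen2 (.wall0TopMain g) ↔ g.InClass) ∧ (VBlen2 (.wall0TopMain g) ↔ g.VerdictMain) :=
  ⟨Iff.rfl, Iff.rfl, Iff.rfl, Iff.rfl, Iff.rfl, Iff.rfl, Iff.rfl, Iff.rfl, Iff.rfl, Iff.rfl, Iff.rfl, Iff.rfl⟩

/-- The main-scale constructors have the SAME class as the trivial-scale rows `wall0` / `wall0top` of v1 (only the slot
scale in the verdict differs) — the bookkeeping behind «supersedes for coverage». [cite: Zhang2022LandauSiegel, §2 (2.16)–(2.20)] -/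
theorem kblen2_wall0Main_iff_wall0 (f : WallZeroDesign) (g : WallZeroTopDesign) :
    (KBlen2 (.wall0Main f) ↔ KBlen (.wall0 f)) ∧ (KBlen2 (.wall0TopMain g) ↔ KBlen (.wall0top g)) :=
  ⟨Iff.rfl, Iff.rfl⟩

/-- **C4 for `lam`** (Blen-typer-1's members of record at the knot `θ = 5/4`: `len-lam-bump-u52-th125` at any amplitude
and the kernel-mode `len-lam-gstar-mv-th125`). [cite: Zhang2022LandauSiegel, §2 (2.23)–(2.25); §7 (7.2)] -/
theorem kblen2_lam_witnesses (c : ℂ) :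
    KBlen2 (.lam (lenLamBump (5/4) (5/2) c)) ∧ KBlen2 (.lam (lenLamGstarMV (5/4) c)) :=
  ⟨inClass_lenLamBump (by norm_num) (5/2) c, inClass_lenLamGstarMV (by norm_num) c⟩

/-- **C4 for `lamGra`**: the bump member of record re-packed without its amplitude. [cite: Zhang2022LandauSiegel, §7 (7.2)] -/
theorem kblen2_lamGra_witness :
    KBlen2 (.lamGra ⟨5/4, kappaP 1 (5/2), kappaP' 1 (5/2), polyPiece (5/4) 1 (bumpPoly (5/4)),
      polyProf' (5/4) (bumpPoly (5/4))⟩) :=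
  have h := inClass_lenLamBump (θ := 5/4) (by norm_num) (5/2) 0
  ⟨h.kinked, h.wall, h.ovh⟩

/-- **C4 for `mu`** (the members of record at the knot `θ = 5/4`: Zhang's one-sided `H₁₁`-type profile `ϰ(5/4, 0)`, the
quadratic and the plateau profiles of the `len-mu-*` rows). [cite: Zhang2022LandauSiegel, §2 (2.23)–(2.25); §7 (7.2)] -/
theorem kblen2_mu_witnesses :
    KBlen2 (.mu (lenMuZhang (5/4))) ∧ KBlen2 (.mu (lenMuQuad (5/4))) ∧ KBlen2 (.mu (lenMuPlateau (5/4))) :=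
  ⟨inClass_lenMuZhang (by norm_num), inClass_lenMuQuad (by norm_num), inClass_lenMuPlateau (by norm_num)⟩

/-- **C4 for `nu`** (the members of record at the knot `θ = 5/4`: the ramp-cut = JUMP row counted here, the continuous
bump, and the Lipschitz tent of the sub-class). [cite: Zhang2022LandauSiegel, §7 (7.2) p.44] -/
theorem kblen2_nu_witnesses :
    KBlen2 (.nu (lenNuRampcut (5/4))) ∧ KBlen2 (.nu (lenNuBump (5/4))) ∧
      KBlen2 (.nu ⟨5/4, lipTent (5/4), fun _ => 0⟩) :=
  ⟨inClass_lenNuPiece (by norm_num) _, inClass_lenNuPiece (by norm_num) _, inClass_lipTent (by norm_num)⟩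

/-- **C4 for `wall0Main` / `wall0TopMain`**: the triangular overhang of `wall0`'s witnesses, top `θ = 2`
(`familyWallZeroMain_inClass_triangle`, same class). [cite: Zhang2022LandauSiegel, §7 (7.2) p.44] -/
theorem kblen2_wall0Main_witnesses (c' : ℝ) :
    KBlen2 (.wall0Main (WallZeroDesign.mk c' fun y => ((max 0 (min (y - 1) (2 - y)) : ℝ) : ℂ))) ∧
      KBlen2 (.wall0TopMain (WallZeroTopDesign.mk ⟨c', fun y => ((max 0 (min (y - 1) (2 - y)) : ℝ) : ℂ)⟩ 2)) :=
  ⟨familyWallZeroMain_inClass_triangle c' (by norm_num) (by norm_num),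
    familyWallZeroTopMain_inClass_triangle c' (by norm_num) (by norm_num)⟩

/-- **Slots load-bearing for the new strata (one term each):** `lam` — the (c)-door is the ONLY door
(`eLambdaOverhangCloses_iff_indefinite`; per member a closing world with `K ≡ 1`: `lambdaOverhangCross_slot_loadBearing`);
`mu` — in the world `M = Re 𝔅_b` (violating E-072's sign) a class member is a robust-margin witness
(`muPsiDiag_slot_loadBearing`). [cite: Zhang2022LandauSiegel, §7 Prop 7.1 (7.2)] -/
theorem blen2_slots_loadBearing {θ b : ℝ} (hb : 1 < b) (K : LambdaDiag) (X : LambdaCross) :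
    (ELambdaOverhangCloses θ K X ↔ LambdaOverhangIndefinite θ K X) ∧
      ¬ MuPsiDiagNonneg b (fun g g' => (topDiagForm b g g').re) :=
  ⟨eLambdaOverhangCloses_iff_indefinite, (muPsiDiag_slot_loadBearing hb).1⟩

/-! ### Part 6 — the list v3: the DECIDED Lipschitz νψ sub-row joins (`familyNuLipOverhangAll`, p470276,
ls-Blen-typer-2 g2, S-E-bt2-2)

C1 unchanged (the §1 word and the (L-b) §2 text quoted VERBATIM above, KILL-draft v2.4 b46628540b6b957c; the family theorems
do not use B-AH). `Repair.familyNuLipOverhangAll` (RepairBlenNuLipschitz.lean, p470276): designs `NuLipDesign (θ, K, v)`,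
class `1 < θ < 2 ∧ LipschitzWith K v ∧ v = 0 off [1,θ]` (NO analytic hypothesis) — the LIPSCHITZ sub-class of the ruling's
νψ class `bvOverhang θ` (by term: `NuLipDesign.InClass.bvOverhang`, `.toNuDesign`; the 36 continuous `len-nu-*` rows of
record are counted HERE, the 12 rampcut jump rows stay under the conditional constructor `nu`); verdict = relative
discrete-mean currency, for EVERY shift `c′`, eventually under the displayed (b)-hypotheses (`Re ρ = ½`, `Re 𝔠*·Re ω ≥ 0`
on `Skeleton.idx χ`), for EVERY bulk table `F`: `¬ (δ·(Ξ(F) + discWeight) + δ²·discWeight < |Ξ(F + A_ν) − Ξ(F)|)`,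
`δ = 4K·𝓛^{−180}` — **DECIDED BY THEOREM, NO slot** (p468144 `abs_discMean_add_nuPoly_sub_le`: the E-074′ invisibility is a
kernel theorem on this sub-class; moreover `nuMeanInvisible_lipOverhang_frakA` discharges the `nu` row's slot at the scale
`𝔞` from Prop71/Lemma81/Prop22i/Lemma23). Flag: UNCONDITIONAL given (b). Writer of this Part: ls-barrier-p1 g2 for
ls-barrier-p3 (ls-barrier-plan g1 21:45:27Z «blenWord3 := blenWord2 ++ [familyNuLipOverhangAll] reserved for S-E-bt2-2»;
ls-Blen-typer-2 g2 21:56:15Z names). FRAMING: the programme SEARCHES and TYPES; no claim about Landau–Siegel zeros,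
Theorems 1–2 of arXiv:2211.02515 or a repaired Margin232 until a kernel theorem says so. -/

/-- **The word's families, v3** = v2 ++ `[familyNuLipOverhangAll]`. [cite: Zhang2022LandauSiegel, §2 (2.32)–(2.33); §4 (4.8)] -/
def blenWord3 : List DesignFamily := blenWord2 ++ [familyNuLipOverhangAll]

/-- **v3 is decided** (`blenWord2_decided`, `familyNuLipOverhangAll_decided`). [cite: Zhang2022LandauSiegel, §2 (2.32)–(2.33)] -/
theorem blenWord3_decided : ClassDecided blenWord3 :=
  classDecided_append.2 ⟨blenWord2_decided, classDecided_cons familyNuLipOverhangAll_decided classDecided_nil⟩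

/-- `R⁺ ++ blenWord3` is decided. [cite: Zhang2022LandauSiegel, §2 (2.32)–(2.33)] -/
theorem rplus_blenWord3_decided : ClassDecided (Rplus ++ blenWord3) :=
  classDecided_append.2 ⟨rplus_decided, blenWord3_decided⟩

/-- v2 is a prefix of v3. [cite: Zhang2022LandauSiegel, §2 (2.32)–(2.33)] -/
theorem blenWord2_sub_blenWord3 : ∀ F ∈ blenWord2, F ∈ blenWord3 :=
  fun _ hF => List.mem_append.2 (Or.inl hF)

/-- The families of v3, by name. [cite: Zhang2022LandauSiegel, §2 (2.32)–(2.33)] -/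
theorem mem_blenWord3_iff (F : DesignFamily) :
    F ∈ blenWord3 ↔ F = familyWallBand ∨ F = familySmoothLengths ∨ F = familySmoothTop ∨ F = familyTwoPiece ∨
      F = familyTwoPieceJoint ∨ F = familyRoughTwoPiece ∨ F = familyRoughThreePiece ∨ F = familyRoughTwoPieceJoint ∨
      F = familyFarPiece ∨ F = familyFarBV ∨ F = familyWallZero ∨ F = familyWallZeroTop ∨ F = familyRLengths ∨
      F = familyInPrintLen ∨ F = familyLambdaOverhangAll ∨ F = familyLambdaGradedAll ∨ F = familyMuPsiOverhangAll ∨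
      F = familyNuOverhangAll ∨ F = familyWallZeroMain ∨ F = familyWallZeroTopMain ∨ F = familyNuLipOverhangAll := by
  simp only [blenWord3, blenWord2, blenWord, List.cons_append, List.nil_append, List.mem_cons, List.not_mem_nil, or_false]

/-- **Designs of `𝒟_len`, v3**: v2 plus `nuLip` (`Repair.NuLipDesign`). [cite: Zhang2022LandauSiegel, §2 (2.32)–(2.33); §7 Prop 7.1 (7.2)] -/
inductive BlenDesign3 : Type
  | ofV2 (d : BlenDesign2)
  | nuLip (d : NuLipDesign)

/-- Membership, v3 (`nuLip`: `1 < θ < 2`, `LipschitzWith K v`, `v = 0` off `[1,θ]`; NO analytic hypothesis).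
[cite: Zhang2022LandauSiegel, §2 (2.32)–(2.33); §7 Prop 7.1 (7.2)] -/
def KBlen3 : BlenDesign3 → Prop
  | .ofV2 d => KBlen2 d
  | .nuLip d => familyNuLipOverhangAll.InClass d

/-- Verdict, v3 (`nuLip`: the slot-free relative discrete-mean verdict over all `c′`).
[cite: Zhang2022LandauSiegel, §2 (2.32)–(2.33); §4 (4.8)] -/
def VBlen3 : BlenDesign3 → Prop
  | .ofV2 d => VBlen2 d
  | .nuLip d => familyNuLipOverhangAll.Verdict d

/-- **`𝒟_len` as one family, v3.** [cite: Zhang2022LandauSiegel, §2 (2.32)–(2.33)] -/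
def familyBlen3 : DesignFamily where
  Design := BlenDesign3
  InClass := KBlen3
  Verdict := VBlen3

/-- **v3 is decided** — by cases (nothing re-proved). [cite: Zhang2022LandauSiegel, §2 (2.32)–(2.33)] -/
theorem familyBlen3_decided : familyBlen3.Decided
  | .ofV2 d, h => familyBlen2_decided d h
  | .nuLip d, h => familyNuLipOverhangAll_decided d h

/-- `R⁺ ++ [𝒟_len v3]` is decided. [cite: Zhang2022LandauSiegel, §2 (2.32)–(2.33)] -/
theorem rplus_blen3_decided : ClassDecided (Rplus ++ [familyBlen3]) :=
  rplus_extend familyBlen3_decided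

/-- v2 embeds into v3 unchanged; the `nuLip` term IS its family's row. [cite: Zhang2022LandauSiegel, §2 (2.32)–(2.33)] -/
theorem kblen3_ofV2_iff (d : BlenDesign2) (e : NuLipDesign) :
    (KBlen3 (.ofV2 d) ↔ KBlen2 d) ∧ (VBlen3 (.ofV2 d) ↔ VBlen2 d) ∧
      (KBlen3 (.nuLip e) ↔ e.InClass) ∧ (VBlen3 (.nuLip e) ↔ e.Verdict) :=
  ⟨Iff.rfl, Iff.rfl, Iff.rfl, Iff.rfl⟩

/-- **C2: every `nuLip` member is a `nu` member** (Lipschitz ⊂ BV: `NuLipDesign.InClass.toNuDesign`) — the two rows share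
members; coverage counts each row once (stronger currency wins). [cite: Zhang2022LandauSiegel, §7 (7.2) p.44] -/
theorem kblen3_nuLip_to_nu {e : NuLipDesign} (h : KBlen3 (.nuLip e)) : KBlen2 (.nu e.toNuDesign) :=
  NuLipDesign.InClass.toNuDesign h

/-- **C4 for `nuLip`** (typer-2's members of record: the bump at the knots `5/4` and `21/20`, the Lipschitz tent at `5/4`).
[cite: Zhang2022LandauSiegel, §7 (7.2) p.44] -/
theorem kblen3_nuLip_witnesses :
    KBlen3 (.nuLip (nuLipBump (5/4))) ∧ KBlen3 (.nuLip (nuLipBump (21/20))) ∧ KBlen3 (.nuLip (nuLipTent (5/4))) :=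
  ⟨inClass_nuLipBump_54, inClass_nuLipBump_2120, inClass_nuLipTent (by norm_num) (by norm_num)⟩

/-! ### Part 7 — the list v4: the (L-b)∣Λ WHOLE-RANGE stratum joins (`familyLambdaWholeAll`, p474795, ls-Blen-typer-1 g3,
S-E-bt1-3) — the sub-word (u6) gets a constructor

C1 unchanged (the §1 word and the (L-b) §2 text quoted VERBATIM above, KILL-draft v2.4 b46628540b6b957c; the family theorems do
not use B-AH). RULING ls-Blen-plan g3 2026-08-26T23:53:33Z (rider r2 of ls-barrier-plan g1 23:12:38Z): the parenthesis
«(or whole profile [0, θ])» is a fragment OF the (L-b) class sentence «(L-b) arithmetic coefficient classes on an OVERHANG piece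
[1, θ] (or whole profile [0, θ]) glued to an in-class bulk: Λχψ-type a(n) = χψ(n)·(Λ^{∗k}/log^k P)(n)·v(z_n), k ≤ 2 (S1-Λ; rows
E-070/E-071); …» ⇒ INSIDE THE WORD ⇒ constructor `lamWhole` (not an R⁺⁺-only row); NO erratum (class text byte-identical; a
sub-word gained a constructor). `Repair.familyLambdaWholeAll` (RepairBlenLambdaWhole.lean, p474795): designs
`LambdaWholeDesign (θ, u, u′, L, v′, c)`, class `KinkedProfile u u′ ∧ u(1) = 0 ∧ L.Whole θ v′` (ONE Λχψ piece, `k ≥ 1` — WIDER than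
the word's `k ≤ 2` —, profile on the WHOLE range `[0,θ]`, `θ > 1`, continuous on `[0,1)` and `[1,θ]`, `L²` marked derivative on
each part, bounded; NO analytic hypothesis); ⊇ the `lam` class (`LambdaOverhangDesign.InClass.toWhole`); verdict = MODEL
currency, worlds `(K, X)` as binders with the slots `LambdaWholeDiagNonneg θ K` ∧ `LambdaWholeCS θ K X` = the E-070/E-071
predicates RE-QUANTIFIED over whole-range pieces (STRONGER hypotheses ⇒ per design a weaker theorem than `lam` on common members,
rider r1); flag CONDITIONAL «GIVEN B-AH (E-014)»; threshold `eLambdaWholeCloses_iff_indefinite`. COVERAGE BOOK (ls-Blen-plan g3):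
(u6) COVERED — conditional, statement level, 0 design rows of record (all 54 Λ rows stay counted ONCE under `lam`); (u7) ν
variants: (a) «ν·log n» and (c) «(1∗χ)(P_j/n)^{b/log P}» COVERED BY THEOREM as members of `nuLip` (RepairBlenNuLipschitz Part 6,
p471332: `NuLipDesign.logTwist` / `.InClass.logTwist`, `NuLipDesign.expTwist` / `.InClass.expTwist`); (b) «ν∗(smooth)» and
(c′) a FIXED exponent `β > 0` remain UNCOVERED sub-words, statement only; u1–u5 stand. Writer of this Part: ls-barrier-p1 g2 for
ls-barrier-p3. FRAMING: the programme SEARCHES and TYPES; no claim about Landau–Siegel zeros, Theorems 1–2 of arXiv:2211.02515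
or a repaired Margin232 until a kernel theorem says so. -/

/-- **The word's families, v4** = v3 ++ `[familyLambdaWholeAll]`. [cite: Zhang2022LandauSiegel, §2 (2.32)–(2.33); §7 Prop 7.1 (7.2)] -/
def blenWord4 : List DesignFamily := blenWord3 ++ [familyLambdaWholeAll]

/-- **v4 is decided** (`blenWord3_decided`, `familyLambdaWholeAll_decided`). [cite: Zhang2022LandauSiegel, §2 (2.32)–(2.33)] -/
theorem blenWord4_decided : ClassDecided blenWord4 :=
  classDecided_append.2 ⟨blenWord3_decided, classDecided_cons familyLambdaWholeAll_decided classDecided_nil⟩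

/-- `R⁺ ++ blenWord4` is decided. [cite: Zhang2022LandauSiegel, §2 (2.32)–(2.33)] -/
theorem rplus_blenWord4_decided : ClassDecided (Rplus ++ blenWord4) :=
  classDecided_append.2 ⟨rplus_decided, blenWord4_decided⟩

/-- v3 is a prefix of v4. [cite: Zhang2022LandauSiegel, §2 (2.32)–(2.33)] -/
theorem blenWord3_sub_blenWord4 : ∀ F ∈ blenWord3, F ∈ blenWord4 :=
  fun _ hF => List.mem_append.2 (Or.inl hF)

/-- The families of v4, by name. [cite: Zhang2022LandauSiegel, §2 (2.32)–(2.33)] -/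
theorem mem_blenWord4_iff (F : DesignFamily) :
    F ∈ blenWord4 ↔ F = familyWallBand ∨ F = familySmoothLengths ∨ F = familySmoothTop ∨ F = familyTwoPiece ∨
      F = familyTwoPieceJoint ∨ F = familyRoughTwoPiece ∨ F = familyRoughThreePiece ∨ F = familyRoughTwoPieceJoint ∨
      F = familyFarPiece ∨ F = familyFarBV ∨ F = familyWallZero ∨ F = familyWallZeroTop ∨ F = familyRLengths ∨
      F = familyInPrintLen ∨ F = familyLambdaOverhangAll ∨ F = familyLambdaGradedAll ∨ F = familyMuPsiOverhangAll ∨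
      F = familyNuOverhangAll ∨ F = familyWallZeroMain ∨ F = familyWallZeroTopMain ∨ F = familyNuLipOverhangAll ∨
      F = familyLambdaWholeAll := by
  simp only [blenWord4, blenWord3, blenWord2, blenWord, List.cons_append, List.nil_append, List.mem_cons, List.not_mem_nil,
    or_false]

/-- **Designs of `𝒟_len`, v4**: v3 plus `lamWhole` (`Repair.LambdaWholeDesign`). [cite: Zhang2022LandauSiegel, §2 (2.32)–(2.33); §7 Prop 7.1 (7.2)] -/
inductive BlenDesign4 : Type
  | ofV3 (d : BlenDesign3)
  | lamWhole (d : LambdaWholeDesign)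

/-- Membership, v4 (`lamWhole`: kinked bulk, `u(1) = 0`, `L.Whole θ v′`; NO analytic hypothesis).
[cite: Zhang2022LandauSiegel, §2 (2.32)–(2.33); §7 Prop 7.1 (7.2)] -/
def KBlen4 : BlenDesign4 → Prop
  | .ofV3 d => KBlen3 d
  | .lamWhole d => familyLambdaWholeAll.InClass d

/-- Verdict, v4 (`lamWhole`: ∀ worlds `(K, X)`, `LambdaWholeDiagNonneg θ K → LambdaWholeCS θ K X → ¬ (lambdaBlockMainTerm … < 0)`).
[cite: Zhang2022LandauSiegel, §2 (2.32)–(2.33); §7 Prop 7.1 (7.2)] -/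
def VBlen4 : BlenDesign4 → Prop
  | .ofV3 d => VBlen3 d
  | .lamWhole d => familyLambdaWholeAll.Verdict d

/-- **`𝒟_len` as one family, v4.** [cite: Zhang2022LandauSiegel, §2 (2.32)–(2.33)] -/
def familyBlen4 : DesignFamily where
  Design := BlenDesign4
  InClass := KBlen4
  Verdict := VBlen4

/-- **v4 is decided** — by cases (nothing re-proved). [cite: Zhang2022LandauSiegel, §2 (2.32)–(2.33)] -/
theorem familyBlen4_decided : familyBlen4.Decided
  | .ofV3 d, h => familyBlen3_decided d h
  | .lamWhole d, h => familyLambdaWholeAll_decided d h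

/-- `R⁺ ++ [𝒟_len v4]` is decided. [cite: Zhang2022LandauSiegel, §2 (2.32)–(2.33)] -/
theorem rplus_blen4_decided : ClassDecided (Rplus ++ [familyBlen4]) :=
  rplus_extend familyBlen4_decided

/-- v3 embeds into v4 unchanged; the `lamWhole` term IS its family's row. [cite: Zhang2022LandauSiegel, §2 (2.32)–(2.33)] -/
theorem kblen4_ofV3_iff (d : BlenDesign3) (e : LambdaWholeDesign) :
    (KBlen4 (.ofV3 d) ↔ KBlen3 d) ∧ (VBlen4 (.ofV3 d) ↔ VBlen3 d) ∧
      (KBlen4 (.lamWhole e) ↔ e.InClass) ∧ (VBlen4 (.lamWhole e) ↔ familyLambdaWholeAll.Verdict e) :=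
  ⟨Iff.rfl, Iff.rfl, Iff.rfl, Iff.rfl⟩

/-- **C2: every `lam` design IS a `lamWhole` design** (`LambdaOverhangDesign.toWhole`, class preserved) — the 54 Λ rows of
record are members of both; coverage counts them ONCE under `lam` (rider r1). [cite: Zhang2022LandauSiegel, §7 (7.2) p.44] -/
theorem kblen4_lam_to_lamWhole {d : LambdaOverhangDesign} (h : KBlen2 (.lam d)) : KBlen4 (.lamWhole d.toWhole) :=
  LambdaOverhangDesign.InClass.toWhole h

/-- **C4 for `lamWhole`** (typer-1's witness by term: the polynomial arch on the whole range over the bulk `ϰ(1, 5/2)` at the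
knot `θ = 5/4`, any amplitude; and the transported bump member of `lam`). [cite: Zhang2022LandauSiegel, §2 (2.23)–(2.25); §7 (7.2)] -/
theorem kblen4_lamWhole_witnesses (c : ℂ) :
    KBlen4 (.lamWhole (lenLamWholeArch (5/4) (5/2) c)) ∧ KBlen4 (.lamWhole (lenLamBump (5/4) (5/2) c).toWhole) :=
  ⟨inClass_lenLamWholeArch (by norm_num) (5/2) c, (inClass_lenLamBump (θ := 5/4) (by norm_num) (5/2) c).toWhole⟩

/-- **(u7) partly COVERED by theorem** (book of ls-Blen-plan g3): the «ν·log n» and «(1∗χ)(P_j/n)^{b/log P}» variants of a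
`nuLip` member are `nuLip` members (RepairBlenNuLipschitz Part 6, p471332). [cite: Zhang2022LandauSiegel, §4 (4.8)] -/
theorem kblen4_nuLip_variants {d : NuLipDesign} (h : KBlen3 (.nuLip d)) (b zj : ℝ) :
    KBlen3 (.nuLip d.logTwist) ∧ KBlen3 (.nuLip (d.expTwist b zj)) :=
  ⟨NuLipDesign.InClass.logTwist h, NuLipDesign.InClass.expTwist h b zj⟩

end Repair

end Literature.NumberTheory.LFunctions.Zhang2022
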